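import Literature.NumberTheory.LFunctions.MontgomeryZeroWindows
import HarnessLib

/-!
# Sums over the zeros of `ζ` in a counting box versus sums over the enumeration `γ_n`

Trunk T-ANT (`Literature/NumberTheory/LFunctions`). Proofs only. The tree counts the zeros of `ζ`
with `0 < Im ρ ≤ T` in two languages: the counting boxes `zetaZeroBox 0 T` with multiplicities
`m(ρ) = riemannZetaZeroOrder ρ` (so that `N(T) = ∑_{ρ ∈ box T} m(ρ)`, `zetaZeroCount_eq_finsum`),
and the enumeration `γ_n = zetaOrdinate n` of the ordinates, non-decreasing and repeated according
to multiplicity, with the dictionary `γ_n ≤ T ↔ n < N(T)` (`Montgomery.zetaOrdinate_le_iff_lt`,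
`MontgomeryZeroWindows.lean`). This file proves that **sums of a function of the ordinate agree**:

* `Montgomery.finsum_zetaZeroBox_mul_eq_sum_range` :
  `∑ᶠ ρ ∈ zetaZeroBox 0 T, m(ρ) · f(Im ρ) = ∑_{n < N(T)} f(γ_n)` for every `f : ℝ → ℂ`, `T : ℝ`,

by comparing multiplicities value by value (`Montgomery.card_filter_zetaOrdinate_eq`:
`#{n < N(T) : γ_n = v} = ∑_{ρ ∈ box T, Im ρ = v} m(ρ)`, both being `N(v) − N(v − ε)` for a gap `ε`
below `v`, `Montgomery.exists_gap_below`). This is the bookkeeping "the zeros … arranged in order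
of increasing ordinate, repeated according to multiplicity" (Titchmarsh §9.1) needed to pass from
residue sums `∑ m(ρ) g(ρ)` (argument principle) to the enumerated sums of `ZeroStatistics.lean`
(e.g. `montgomeryZeroSum`), under RH where `ρ = 1/2 + iγ`.

## References

* E. C. Titchmarsh, *The Theory of the Riemann Zeta-Function*, 2nd ed. (rev. D. R. Heath-Brown),
  OUP 1986, §9.1.
-/

noncomputable section

open Complex Set

namespace Literature.NumberTheory.LFunctions

namespace Montgomery

/-- **A gap below any height.** For every real `v` there is `ε > 0` such that every zero of the
counting box at height `v` has ordinate `≤ v − ε` or exactly `v` (the box is finite). [folklore] -/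
theorem exists_gap_below (v : ℝ) :
    ∃ ε : ℝ, 0 < ε ∧ ∀ ρ ∈ zetaZeroBox 0 v, ρ.im ≤ v - ε ∨ ρ.im = v := by
  classical
  set F : Finset ℂ := (zetaZeroBox_finite 0 v).toFinset with hF
  set D : Finset ℝ := insert 1 ((F.filter fun ρ ↦ ρ.im ≠ v).image fun ρ ↦ v - ρ.im) with hD
  have hDne : D.Nonempty := ⟨1, Finset.mem_insert_self _ _⟩
  have hDpos : ∀ d ∈ D, 0 < d := by
    intro d hd
    rcases Finset.mem_insert.1 hd with rfl | hd
    · exact one_pos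
    · obtain ⟨ρ, hρ, rfl⟩ := Finset.mem_image.1 hd
      rw [Finset.mem_filter] at hρ
      have hρ' : ρ ∈ zetaZeroBox 0 v := (Set.Finite.mem_toFinset _).1 hρ.1
      have h4 := hρ'.2.2.2.2
      have : ρ.im < v := lt_of_le_of_ne h4 hρ.2
      linarith
  set ε : ℝ := D.min' hDne with hε
  have hεpos : 0 < ε := hDpos _ (D.min'_mem hDne)
  refine ⟨ε, hεpos, fun ρ hρ ↦ ?_⟩
  by_cases him : ρ.im = v
  · exact Or.inr him
  · left
    have hmem : ρ ∈ F.filter fun ρ ↦ ρ.im ≠ v := by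
      rw [Finset.mem_filter]; exact ⟨(Set.Finite.mem_toFinset _).2 hρ, him⟩
    have : ε ≤ v - ρ.im :=
      D.min'_le _ (Finset.mem_insert_of_mem (Finset.mem_image_of_mem _ hmem))
    linarith

/-- The counting boxes increase with the height. [folklore] -/
theorem zetaZeroBox_mono {u v : ℝ} (huv : u ≤ v) : zetaZeroBox 0 u ⊆ zetaZeroBox 0 v :=
  fun _ h ↦ ⟨h.1, h.2.1, h.2.2.1, h.2.2.2.1, h.2.2.2.2.trans huv⟩

/-- `N(v) − N(u) = ∑_{ρ ∈ box v ∖ box u} m(ρ)` for `u ≤ v`. [folklore] -/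
theorem zetaZeroCount_sub_eq_finsum {u v : ℝ} (huv : u ≤ v) :
    (zetaZeroCount v : ℤ) - zetaZeroCount u =
      ∑ᶠ ρ ∈ zetaZeroBox 0 v \ zetaZeroBox 0 u, riemannZetaZeroOrder ρ := by
  rw [zetaZeroCount_eq_finsum, zetaZeroCount_eq_finsum]
  have h := finsum_mem_union (f := riemannZetaZeroOrder) (Set.disjoint_sdiff_right
    (s := zetaZeroBox 0 u) (t := zetaZeroBox 0 v)) (zetaZeroBox_finite 0 u)
    ((zetaZeroBox_finite 0 v).subset Set.sdiff_subset)
  rw [Set.union_sdiff_cancel (zetaZeroBox_mono huv)] at h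
  rw [h]
  ring

/-- With a gap `ε` below `v`: `box v ∖ box (v − ε)` is the set of zeros of the box with ordinate
exactly `v`. [folklore] -/
theorem zetaZeroBox_diff_eq {v ε : ℝ} (hε : 0 < ε)
    (hgap : ∀ ρ ∈ zetaZeroBox 0 v, ρ.im ≤ v - ε ∨ ρ.im = v) :
    zetaZeroBox 0 v \ zetaZeroBox 0 (v - ε) = {ρ | ρ ∈ zetaZeroBox 0 v ∧ ρ.im = v} := by
  ext ρ
  simp only [Set.mem_sdiff, Set.mem_setOf_eq]
  constructor
  · rintro ⟨hv, hnot⟩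
    refine ⟨hv, (hgap ρ hv).resolve_left fun hle ↦ hnot ?_⟩
    exact ⟨hv.1, hv.2.1, hv.2.2.1, hv.2.2.2.1, hle⟩
  · rintro ⟨hv, him⟩
    refine ⟨hv, fun h ↦ ?_⟩
    have := h.2.2.2.2
    linarith

/-- With a gap `ε` below `v`: `γ_n < v ↔ γ_n ≤ v − ε` (each `γ_n` is the ordinate of a zero of the
box at height `γ_n`, `exists_zero_of_zetaOrdinate_holds`). [folklore] -/
theorem zetaOrdinate_lt_iff_le_sub {v ε : ℝ} (hε : 0 < ε)
    (hgap : ∀ ρ ∈ zetaZeroBox 0 v, ρ.im ≤ v - ε ∨ ρ.im = v) (n : ℕ) :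
    zetaOrdinate n < v ↔ zetaOrdinate n ≤ v - ε := by
  constructor
  · intro hlt
    obtain ⟨σ, h0, h1, hζ⟩ := exists_zero_of_zetaOrdinate_holds n
    have hpos := zetaOrdinate_pos_holds n
    have hmem : (σ : ℂ) + zetaOrdinate n * I ∈ zetaZeroBox 0 v := by
      refine ⟨hζ, ?_, ?_, ?_, ?_⟩ <;> simp <;> linarith
    rcases hgap _ hmem with h | h
    · simpa using h
    · simp at h; linarith
  · intro h; linarith

/-- **Multiplicity bookkeeping.** For real `T, v`: the number of indices `n < N(T)` with
`γ_n = v` equals `∑ m(ρ)` over the zeros `ρ` of the box at height `T` with `Im ρ = v`. [folklore] -/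
theorem card_filter_zetaOrdinate_eq (T v : ℝ) :
    (((Finset.range (zetaZeroCount T)).filter fun n ↦ zetaOrdinate n = v).card : ℤ) =
      ∑ᶠ ρ ∈ {ρ | ρ ∈ zetaZeroBox 0 T ∧ ρ.im = v}, riemannZetaZeroOrder ρ := by
  rcases le_or_gt v T with hvT | hvT
  · obtain ⟨ε, hε, hgap⟩ := exists_gap_below v
    -- the indices with `γ_n = v` form the interval `[N(v−ε), N(v))`
    have hset : ((Finset.range (zetaZeroCount T)).filter fun n ↦ zetaOrdinate n = v) =
        Finset.Ico (zetaZeroCount (v - ε)) (zetaZeroCount v) := by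
      ext n
      rw [Finset.mem_filter, Finset.mem_range, Finset.mem_Ico, ← zetaOrdinate_le_iff_lt,
        ← zetaOrdinate_le_iff_lt, ← lt_zetaOrdinate_iff]
      constructor
      · rintro ⟨-, h⟩
        refine ⟨?_, h.le⟩
        by_contra hle
        push Not at hle
        linarith
      · rintro ⟨h1, h2⟩
        have hnlt : ¬ zetaOrdinate n < v := fun h ↦ by
          have := (zetaOrdinate_lt_iff_le_sub hε hgap n).1 h
          linarith
        have heq : zetaOrdinate n = v := le_antisymm h2 (not_lt.1 hnlt)
        exact ⟨by rw [heq]; exact hvT, heq⟩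
    have hmono : zetaZeroCount (v - ε) ≤ zetaZeroCount v := zetaZeroCount_mono (by linarith)
    rw [hset, Nat.card_Ico, Nat.cast_sub hmono]
    -- the zeros of `box T` with ordinate `v` are those of `box v`
    have hset2 : {ρ | ρ ∈ zetaZeroBox 0 T ∧ ρ.im = v} = {ρ | ρ ∈ zetaZeroBox 0 v ∧ ρ.im = v} := by
      ext ρ
      simp only [Set.mem_setOf_eq]
      constructor
      · rintro ⟨h, him⟩
        exact ⟨⟨h.1, h.2.1, h.2.2.1, h.2.2.2.1, him.le⟩, him⟩
      · rintro ⟨h, him⟩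
        exact ⟨zetaZeroBox_mono hvT h, him⟩
    rw [hset2, ← zetaZeroBox_diff_eq hε hgap, ← zetaZeroCount_sub_eq_finsum (by linarith)]
  · -- `v > T`: both sides vanish
    have h1 : ((Finset.range (zetaZeroCount T)).filter fun n ↦ zetaOrdinate n = v) = ∅ := by
      ext n
      simp only [Finset.mem_filter, Finset.mem_range, Finset.notMem_empty, iff_false, not_and]
      intro hn heq
      have := zetaOrdinate_le_iff_lt.2 hn
      linarith
    have h2 : {ρ | ρ ∈ zetaZeroBox 0 T ∧ ρ.im = v} = ∅ := by
      ext ρ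
      simp only [Set.mem_setOf_eq, Set.mem_empty_iff_false, iff_false, not_and]
      intro h him
      have := h.2.2.2.2
      linarith
    rw [h1, h2, Finset.card_empty, finsum_mem_empty]
    simp

/-- **Sums over the zeros of a box are sums over the enumeration.** For every `f : ℝ → ℂ` and
real `T`:
`∑_{ρ ∈ box T} m(ρ) f(Im ρ) = ∑_{n < N(T)} f(γ_n)`, where `box T = {ζ(ρ) = 0, 0 ≤ Re ρ ≤ 1,
0 < Im ρ ≤ T}` with multiplicities `m(ρ)`, `N(T) = zetaZeroCount T`, `γ_n = zetaOrdinate n`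
(Titchmarsh §9.1: "the zeros … arranged in order of increasing ordinate, repeated according to
multiplicity"). [cite: Titchmarsh1986, §9.1] -/
theorem finsum_zetaZeroBox_mul_eq_sum_range (f : ℝ → ℂ) (T : ℝ) :
    ∑ᶠ ρ ∈ zetaZeroBox 0 T, (riemannZetaZeroOrder ρ : ℂ) * f ρ.im =
      ∑ n ∈ Finset.range (zetaZeroCount T), f (zetaOrdinate n) := by
  classical
  set BF : Finset ℂ := (zetaZeroBox_finite 0 T).toFinset with hBF
  set R : Finset ℕ := Finset.range (zetaZeroCount T) with hR
  set W : Finset ℝ := BF.image Complex.im ∪ R.image zetaOrdinate with hW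
  have hmapsB : ∀ ρ ∈ BF, ρ.im ∈ W := fun ρ hρ ↦
    Finset.mem_union_left _ (Finset.mem_image_of_mem _ hρ)
  have hmapsR : ∀ n ∈ R, zetaOrdinate n ∈ W := fun n hn ↦
    Finset.mem_union_right _ (Finset.mem_image_of_mem _ hn)
  -- the common multiplicity of a value `v`
  have hmult : ∀ v : ℝ, (((R.filter fun n ↦ zetaOrdinate n = v).card : ℤ) : ℂ) =
      ∑ ρ ∈ BF.filter (fun ρ ↦ ρ.im = v), (riemannZetaZeroOrder ρ : ℂ) := by
    intro v
    rw [hR, card_filter_zetaOrdinate_eq T v]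
    have hfin : {ρ | ρ ∈ zetaZeroBox 0 T ∧ ρ.im = v}.Finite :=
      (zetaZeroBox_finite 0 T).subset fun ρ h ↦ h.1
    rw [finsum_mem_eq_finite_toFinset_sum _ hfin, Int.cast_sum]
    refine Finset.sum_congr ?_ fun _ _ ↦ rfl
    ext ρ
    simp [hBF]
  calc ∑ᶠ ρ ∈ zetaZeroBox 0 T, (riemannZetaZeroOrder ρ : ℂ) * f ρ.im
      = ∑ ρ ∈ BF, (riemannZetaZeroOrder ρ : ℂ) * f ρ.im :=
        finsum_mem_eq_finite_toFinset_sum _ (zetaZeroBox_finite 0 T)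
    _ = ∑ v ∈ W, ∑ ρ ∈ BF.filter (fun ρ ↦ ρ.im = v), (riemannZetaZeroOrder ρ : ℂ) * f ρ.im :=
        (Finset.sum_fiberwise_of_maps_to hmapsB _).symm
    _ = ∑ v ∈ W, (∑ ρ ∈ BF.filter (fun ρ ↦ ρ.im = v), (riemannZetaZeroOrder ρ : ℂ)) * f v := by
        refine Finset.sum_congr rfl fun v _ ↦ ?_
        rw [Finset.sum_mul]
        refine Finset.sum_congr rfl fun ρ hρ ↦ ?_
        rw [(Finset.mem_filter.1 hρ).2]
    _ = ∑ v ∈ W, (((R.filter fun n ↦ zetaOrdinate n = v).card : ℤ) : ℂ) * f v := by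
        refine Finset.sum_congr rfl fun v _ ↦ ?_
        rw [hmult v]
    _ = ∑ v ∈ W, ∑ n ∈ R.filter (fun n ↦ zetaOrdinate n = v), f (zetaOrdinate n) := by
        refine Finset.sum_congr rfl fun v _ ↦ ?_
        rw [Finset.sum_congr rfl fun n hn ↦ by rw [(Finset.mem_filter.1 hn).2], Finset.sum_const,
          nsmul_eq_mul]
        push_cast
        ring
    _ = ∑ n ∈ R, f (zetaOrdinate n) := Finset.sum_fiberwise_of_maps_to hmapsR _

end Montgomery

end Literature.NumberTheory.LFunctions

end
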